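import Mathlib
import Literature.Algebra.Polynomial.GramMatrixMethod
import HarnessLib

/-!
# Parrilo's sum-of-squares cones `K^{(r)}_n` for copositive matrices

Literature anchor (engines/certsdp SOS lane). For a real `V × V` matrix `M` put
`p_M(x) = xᵀ M x` (`quadPoly M`) and `P_M(x) = p_M(x^{∘2}) = ∑_{i,j} M_{ij} xᵢ² xⱼ²` (`evenForm M`,
the image of `p_M` under the square substitution `sqLift : xᵢ ↦ xᵢ²`). Parrilo's cone `K^{(r)}_n`
consists of the matrices `M` for which `(∑ᵢ xᵢ²)^r · P_M` is a sum of squares of polynomials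
(`InParriloCone r M`; membership is a semidefinite feasibility problem via a Gram matrix).
Main statements:

* `InParriloCone.mono` — `K^{(r)}_n ⊆ K^{(s)}_n` for `r ≤ s`;
* `InParriloCone.copositive` — `K^{(r)}_n ⊆ COP_n` (evaluate the certificate at `√x`);
* `isSumSq_sqLift_of_coeff_nonneg`, `inParriloCone_of_coeff_nonneg` — the even lift of a
  polynomial with nonnegative coefficients is SOS, whence the de Klerk–Pasechnik LP cones satisfy
  `C^{(r)}_n ⊆ K^{(r)}_n`;
* `inParriloCone_zero_iff` — **Parrilo**: for symmetric `M`, `M ∈ K^{(0)}_n ↔ M = P + N` with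
  `P ⪰ 0` and `N ≥ 0` entrywise (w.l.o.g. `N_{ii} = 0`). The easy half is
  `inParriloCone_zero_of_posSemidef_add_nonneg`; the hard half
  `exists_posSemidef_add_nonneg_of_inParriloCone_zero` reads `P` and `N` off a positive
  semidefinite Gram matrix on the monomials of degree `≤ 2` supplied by the in-tree Gram-matrix
  method (`GramMatrixMethod.isSumSq_iff_exists_posSemidef_coeff`): only `(2eᵢ, 2eᵢ)` produces
  `xᵢ⁴` and only `(2eᵢ, 2e_k), (eᵢ + e_k, eᵢ + e_k), (2e_k, 2eᵢ)` produce `xᵢ² x_k²`;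
* `inParriloCone_succ_of_decomposition` — the Gvozdenović–Laurent sufficient condition for
  `K^{(t+1)}_n` (`M - M⁽ⁱ⁾ ∈ K^{(t)}_n`, `M⁽ⁱ⁾_{jk} + M⁽ʲ⁾_{ik} + M⁽ᵏ⁾_{ij} ≥ 0`); with `t = 0` it is
  the sufficiency half of the Bomze–de Klerk description of `K^{(1)}_n`;
* `copositive_of_posSemidef_add_nonneg` — `𝒮⁺_n + 𝒩_n ⊆ COP_n`.

Sources: [LaurentVargas2022, §1 p. 3 (`p_M`, `P_M = p_M(x^{∘2})`, `C^{(r)}_n ⊆ K^{(r)}_n ⊆ COP_n`),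
Prop 3.7 (`K^{(0)}_n = {P + N}`, after Parrilo's 2000 thesis), Thm 3.6 (easy direction only)];
[Gvozdenovic2008, §4.2.1: Thm 4.2.1, (4.27), "`K^{(0)}_n = S_n^+ + N_n`", Thm 4.2.2 (Bomze–de Klerk),
Lemma 4.2.3 with its proof (4.31)–(4.32)]; [DeklerkPasechnik2002, §4]. Lemma 4.2.3 (and the
`α(G) ≤ 8` theorem built on it) originate in the Gvozdenović–Laurent paper [GvozdenovicLaurent2006]
(reference [39] of [Gvozdenovic2008]); we cite the thesis, whose text we hold.

Not treated here: the necessity half of the Bomze–de Klerk characterisation of `K^{(1)}_n`; the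
hard direction of [LaurentVargas2022, Thm 3.6] (`(∑xᵢ²)^r P_M` SOS ⇒ a Putinar-type representation
of `p_M` on the simplex); `K^{(0)}_5 ≠ COP_5` (Horn matrix) and `K^{(r)}_n ≠ COP_n`; the graph
bounds `ϑ^{(r)}(G)` (their LP analogues `ζ^{(r)}(G)` live in
`Literature.Combinatorics.Optimization.MotzkinStrausCopositive`).
-/

noncomputable section

open MvPolynomial Matrix Finset

open scoped BigOperators

namespace Literature.Algebra.Polynomial.ParriloCopositiveSos

open Literature.Algebra.Polynomial.GramMatrixMethod

variable {V : Type*} [Fintype V]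

/-! ## Sums of squares: closure facts -/

section SumSq

variable {R : Type*} [CommSemiring R]

omit [Fintype V] in
/-- A ring homomorphism maps sums of squares to sums of squares. [folklore] -/
@[folklore] private theorem isSumSq_map {S : Type*} [CommSemiring S] (φ : R →+* S) {p : R}
    (hp : IsSumSq p) : IsSumSq (φ p) := by
  induction hp with
  | zero => rw [map_zero]; exact IsSumSq.zero
  | sq_add a hs ih => rw [map_add, map_mul]; exact IsSumSq.sq_add _ ih

omit [Fintype V] in
/-- Powers of a sum of squares are sums of squares. [folklore] -/
@[folklore] private theorem isSumSq_pow {p : R} (hp : IsSumSq p) (r : ℕ) : IsSumSq (p ^ r) := by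
  induction r with
  | zero => rw [pow_zero, ← mul_one (1 : R)]; exact IsSumSq.mul_self (1 : R)
  | succ r ih => rw [pow_succ]; exact ih.mul hp

/-- `∑ᵢ xᵢ²` is a sum of squares. [folklore] -/
@[folklore] private theorem isSumSq_sumSq : IsSumSq (∑ i, X i ^ 2 : MvPolynomial V R) := by
  simp only [sq]; exact IsSumSq.sum_mul_self _ _

omit [Fintype V] in
/-- A positive constant is a sum of squares (`c = (√c)²`). [folklore] -/
@[folklore] private theorem isSumSq_C {c : ℝ} (hc : 0 ≤ c) : IsSumSq (C c : MvPolynomial V ℝ) := by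
  rw [← Real.mul_self_sqrt hc, map_mul]; exact IsSumSq.mul_self _

omit [Fintype V] in
/-- A sum of squares of real polynomials is nonnegative everywhere. [folklore] -/
@[folklore] private theorem eval_nonneg_of_isSumSq {p : MvPolynomial V ℝ} (hp : IsSumSq p)
    (x : V → ℝ) : 0 ≤ eval x p :=
  (isSumSq_map (eval x) hp).nonneg

end SumSq

/-! ## The substitution `x ↦ x^{∘2} = (x₁², …, xₙ²)` -/

section SqLift

/-- The square substitution `f(x) ↦ f(x₁², …, xₙ²)` (`P_M(x) = p_M(x^{∘2})` in
[cite: LaurentVargas2022, §1 (P_M = p_M(x^{∘2}))]). -/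
def sqLift : MvPolynomial V ℝ →ₐ[ℝ] MvPolynomial V ℝ := bind₁ fun i => X i ^ 2

omit [Fintype V] in
/-- `sqLift xᵢ = xᵢ²` [cite: LaurentVargas2022, §1 (x^{∘2})]. -/
theorem sqLift_X (i : V) : sqLift (X i : MvPolynomial V ℝ) = X i ^ 2 := bind₁_X_right _ _

omit [Fintype V] in
/-- `sqLift` fixes constants [cite: LaurentVargas2022, §1 (x^{∘2})]. -/
theorem sqLift_C (a : ℝ) : sqLift (C a : MvPolynomial V ℝ) = C a := bind₁_C_right _ _

omit [Fintype V] in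
/-- Semantics of the square substitution: `(sqLift f)(x) = f(x₁², …, xₙ²)`
[cite: LaurentVargas2022, §1 (P_M(x) = p_M(x^{∘2}))]. -/
theorem eval_sqLift (f : MvPolynomial V ℝ) (x : V → ℝ) :
    eval x (sqLift f) = eval (fun i => x i ^ 2) f := by
  induction f using MvPolynomial.induction_on with
  | C a => rw [sqLift_C, eval_C, eval_C]
  | add p q hp hq => rw [map_add, map_add, map_add, hp, hq]
  | mul_X p i hp => rw [map_mul, map_mul, map_mul, hp, sqLift_X, map_pow, eval_X, eval_X]

omit [Fintype V] in
/-- **Even lifts of polynomials with nonnegative coefficients are sums of squares**: if every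
coefficient of `f` is `≥ 0` then `f(x^{∘2}) = ∑_m f_m (x^m)²` is SOS — the mechanism behind
`C^{(r)}_n ⊆ K^{(r)}_n` [cite: LaurentVargas2022, §1 ("C^{(r)}_n ⊆ K^{(r)}_n ⊆ COP_n")]
[cite: Gvozdenovic2008, §4.2.1]. -/
theorem isSumSq_sqLift_of_coeff_nonneg (f : MvPolynomial V ℝ) (hf : ∀ m, 0 ≤ coeff m f) :
    IsSumSq (sqLift f) := by
  classical
  rw [f.as_sum, map_sum]
  refine IsSumSq.sum fun m _ => ?_
  rw [sqLift, bind₁_monomial]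
  have : C (coeff m f) * ∏ i ∈ m.support, (X i ^ 2 : MvPolynomial V ℝ) ^ (m i) =
      (C (Real.sqrt (coeff m f)) * ∏ i ∈ m.support, X i ^ (m i)) *
        (C (Real.sqrt (coeff m f)) * ∏ i ∈ m.support, X i ^ (m i)) := by
    rw [mul_mul_mul_comm, ← map_mul, Real.mul_self_sqrt (hf m), ← Finset.prod_mul_distrib]
    congr 1
    exact Finset.prod_congr rfl fun i _ => by ring
  rw [this]
  exact IsSumSq.mul_self _

omit [Fintype V] in
/-- Even lifts of sums of squares are sums of squares (`σ(x^{∘2})` is SOS for `σ` SOS)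
[cite: LaurentVargas2022, Thm 3.6 (the easy direction)]. -/
theorem isSumSq_sqLift_of_isSumSq {f : MvPolynomial V ℝ} (hf : IsSumSq f) : IsSumSq (sqLift f) :=
  isSumSq_map (sqLift : MvPolynomial V ℝ →ₐ[ℝ] MvPolynomial V ℝ).toRingHom hf

end SqLift

/-! ## The cones `K^{(r)}_n` -/

section Cones

variable [DecidableEq V]

/-- The quadratic form `p_M(x) = xᵀ M x = ∑_{i,j} M_{ij} xᵢ xⱼ` as a polynomial
[cite: LaurentVargas2022, §1 (p_M)]. -/
def quadPoly (M : Matrix V V ℝ) : MvPolynomial V ℝ := ∑ i, ∑ j, C (M i j) * X i * X j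

/-- The even quartic form `P_M(x) = p_M(x^{∘2}) = ∑_{i,j} M_{ij} xᵢ² xⱼ²`
[cite: LaurentVargas2022, §1 (P_M)] [cite: Gvozdenovic2008, §4.2.1 (4.27)]. -/
def evenForm (M : Matrix V V ℝ) : MvPolynomial V ℝ := ∑ i, ∑ j, C (M i j) * X i ^ 2 * X j ^ 2

omit [DecidableEq V] in
/-- `P_M = p_M(x^{∘2})` [cite: LaurentVargas2022, §1 (P_M(x) = p_M(x^{∘2}))]. -/
theorem sqLift_quadPoly (M : Matrix V V ℝ) : sqLift (quadPoly M) = evenForm M := by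
  simp only [quadPoly, evenForm, map_sum, map_mul, sqLift_X, sqLift_C]

omit [DecidableEq V] in
/-- `P_M(x) = ∑ M_{ij} xᵢ² xⱼ²` pointwise [cite: LaurentVargas2022, §1 (P_M)]. -/
theorem eval_evenForm (M : Matrix V V ℝ) (x : V → ℝ) :
    eval x (evenForm M) = ∑ i, ∑ j, M i j * x i ^ 2 * x j ^ 2 := by
  simp only [evenForm, map_sum, map_mul, eval_C, map_pow, eval_X]

omit [DecidableEq V] in
/-- `p_M(x) = xᵀ M x` pointwise [cite: LaurentVargas2022, §1 (p_M)]. -/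
theorem eval_quadPoly (M : Matrix V V ℝ) (x : V → ℝ) :
    eval x (quadPoly M) = x ⬝ᵥ M *ᵥ x := by
  simp only [quadPoly, map_sum, map_mul, eval_C, eval_X, dotProduct, mulVec, Finset.mul_sum]
  exact Finset.sum_congr rfl fun i _ => Finset.sum_congr rfl fun j _ => by ring

/-- **Parrilo's cone `K^{(r)}_n`**: the matrices `M` for which `(∑ᵢ xᵢ²)^r · P_M(x)` is a sum of
squares of polynomials [cite: LaurentVargas2022, §1 (K^{(r)}_n)] [cite: Gvozdenovic2008, §4.2.1
(4.27)] [cite: DeklerkPasechnik2002, §4]. -/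
def InParriloCone (r : ℕ) (M : Matrix V V ℝ) : Prop :=
  IsSumSq ((∑ i, X i ^ 2 : MvPolynomial V ℝ) ^ r * evenForm M)

omit [DecidableEq V] in
/-- **`K^{(r)}_n ⊆ K^{(r+1)}_n ⊆ ⋯`** [cite: Gvozdenovic2008, §4.2.1 ("K^{(0)} ⊆ ⋯ ⊆ K^{(t)} ⊆
K^{(t+1)} ⊆ ⋯ ⊆ C_n")] [cite: LaurentVargas2022, §1]. -/
theorem InParriloCone.mono {r s : ℕ} (hrs : r ≤ s) {M : Matrix V V ℝ} (h : InParriloCone r M) :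
    InParriloCone s M := by
  obtain ⟨d, rfl⟩ := Nat.exists_eq_add_of_le hrs
  have : (∑ i, X i ^ 2 : MvPolynomial V ℝ) ^ (r + d) * evenForm M =
      (∑ i, X i ^ 2 : MvPolynomial V ℝ) ^ d * ((∑ i, X i ^ 2 : MvPolynomial V ℝ) ^ r * evenForm M) := by
    ring
  rw [InParriloCone, this]
  exact (isSumSq_pow isSumSq_sumSq d).mul h

omit [DecidableEq V] in
/-- **`K^{(r)}_n ⊆ COP_n`**: a matrix in Parrilo's cone is copositive (`xᵀMx ≥ 0` for `x ≥ 0`):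
evaluate the SOS certificate at `(√x₁, …, √xₙ)` [cite: LaurentVargas2022, §1 ("K^{(r)}_n ⊆ COP_n")]
[cite: Gvozdenovic2008, §4.2.1]. -/
theorem InParriloCone.copositive {r : ℕ} {M : Matrix V V ℝ} (h : InParriloCone r M) (x : V → ℝ)
    (hx : ∀ i, 0 ≤ x i) : 0 ≤ x ⬝ᵥ M *ᵥ x := by
  have hev := eval_nonneg_of_isSumSq h (fun i => Real.sqrt (x i))
  rw [map_mul, map_pow, map_sum] at hev
  simp only [map_pow, eval_X, Real.sq_sqrt (hx _), eval_evenForm] at hev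
  have hform : ∑ i, ∑ j, M i j * x i * x j = x ⬝ᵥ M *ᵥ x := by
    simp only [dotProduct, mulVec, Finset.mul_sum]
    exact Finset.sum_congr rfl fun i _ => Finset.sum_congr rfl fun j _ => by ring
  rw [hform] at hev
  by_cases hs : ∑ i, x i = 0
  · have hx0 : ∀ i, x i = 0 := fun i =>
      (Finset.sum_eq_zero_iff_of_nonneg fun j _ => hx j).1 hs i (Finset.mem_univ i)
    simp [dotProduct, hx0]
  · have hpos : 0 < (∑ i, x i) ^ r :=
      pow_pos (lt_of_le_of_ne (Finset.sum_nonneg fun i _ => hx i) (Ne.symm hs)) r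
    exact (mul_nonneg_iff_of_pos_left hpos).1 hev

omit [DecidableEq V] in
/-- **`C^{(r)}_n ⊆ K^{(r)}_n`**: if `(∑ xᵢ)^r p_M(x)` has nonnegative coefficients (i.e. `M` lies in
the de Klerk–Pasechnik LP cone `C^{(r)}_n`), then `(∑ xᵢ²)^r P_M(x)` — its even lift — is a sum
of squares [cite: LaurentVargas2022, §1 ("C^{(r)}_n ⊆ K^{(r)}_n")] [cite: DeklerkPasechnik2002, §4]. -/
theorem inParriloCone_of_coeff_nonneg {r : ℕ} {M : Matrix V V ℝ}
    (h : ∀ m, 0 ≤ coeff m ((∑ i, X i : MvPolynomial V ℝ) ^ r * quadPoly M)) :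
    InParriloCone r M := by
  have := isSumSq_sqLift_of_coeff_nonneg _ h
  rw [map_mul, map_pow, map_sum, sqLift_quadPoly] at this
  simp only [sqLift_X] at this
  exact this

/-! ### `K^{(0)}_n = 𝒮⁺_n + 𝒩_n` (Parrilo): the easy inclusion -/

/-- The easy half of Parrilo's characterisation: `P ⪰ 0` and `N ≥ 0` entrywise give
`P_{P+N} = (x^{∘2})ᵀ P x^{∘2} + ∑ N_{ij} (xᵢxⱼ)²`, a sum of squares
[cite: LaurentVargas2022, Prop 3.7] [cite: Gvozdenovic2008, §4.2.1 ("K^{(0)}_n = S_n^+ + N_n")]. -/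
theorem inParriloCone_zero_of_posSemidef_add_nonneg {M P N : Matrix V V ℝ} (hP : P.PosSemidef)
    (hN : ∀ i j, 0 ≤ N i j) (hM : M = P + N) : InParriloCone 0 M := by
  rw [InParriloCone, pow_zero, one_mul, hM]
  have hsplit : evenForm (P + N) = gramPoly P (fun i => X i ^ 2) + evenForm N := by
    unfold evenForm gramPoly
    rw [← Finset.sum_add_distrib]
    refine Finset.sum_congr rfl fun i _ => ?_
    rw [← Finset.sum_add_distrib]
    refine Finset.sum_congr rfl fun j _ => ?_
    rw [Matrix.add_apply, map_add]
    ring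
  rw [hsplit]
  refine (isSumSq_gramPoly_of_posSemidef hP _).add (IsSumSq.sum fun i _ => IsSumSq.sum fun j _ => ?_)
  have : C (N i j) * X i ^ 2 * X j ^ 2 = C (N i j) * ((X i * X j) * (X i * X j) : MvPolynomial V ℝ) := by
    ring
  rw [this]
  exact (isSumSq_C (hN i j)).mul (IsSumSq.mul_self _)

/-- In particular `𝒮⁺_n ⊆ K^{(0)}_n` [cite: LaurentVargas2022, Prop 3.7]. -/
theorem inParriloCone_zero_of_posSemidef {P : Matrix V V ℝ} (hP : P.PosSemidef) :
    InParriloCone 0 P :=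
  inParriloCone_zero_of_posSemidef_add_nonneg hP (N := 0) (fun _ _ => le_rfl) (add_zero P).symm

/-- In particular `𝒩_n ⊆ K^{(0)}_n` [cite: LaurentVargas2022, Prop 3.7]. -/
theorem inParriloCone_zero_of_nonneg {N : Matrix V V ℝ} (hN : ∀ i j, 0 ≤ N i j) :
    InParriloCone 0 N :=
  inParriloCone_zero_of_posSemidef_add_nonneg PosSemidef.zero hN (zero_add N).symm

/-! ### The Gvozdenović–Laurent sufficient condition for `K^{(t+1)}_n` -/

omit [DecidableEq V] in
/-- Swap the two outer indices of a triple sum. [folklore] -/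
@[folklore] private theorem sum₃_swap {α : Type*} [AddCommMonoid α] (f : V → V → V → α) :
    ∑ i, ∑ j, ∑ k, f i j k = ∑ i, ∑ j, ∑ k, f j i k := Finset.sum_comm

omit [DecidableEq V] in
/-- Cyclically permute the indices of a triple sum. [folklore] -/
@[folklore] private theorem sum₃_cycl {α : Type*} [AddCommMonoid α] (f : V → V → V → α) :
    ∑ i, ∑ j, ∑ k, f i j k = ∑ i, ∑ j, ∑ k, f j k i :=
  (Finset.sum_congr rfl fun _ _ => Finset.sum_comm).trans Finset.sum_comm

omit [DecidableEq V] in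
/-- `3 ∑ᵢ xᵢ² P_{M⁽ⁱ⁾}(x) = ∑_{i,j,k} (M⁽ⁱ⁾_{jk} + M⁽ʲ⁾_{ik} + M⁽ᵏ⁾_{ij}) xᵢ²xⱼ²x_k²` (symmetrise the
triple sum over its three slots). [folklore] -/
@[folklore] private theorem three_mul_sum_X_sq_mul_evenForm (Ms : V → Matrix V V ℝ) :
    3 * ∑ i, X i ^ 2 * evenForm (Ms i) = ∑ i, ∑ j, ∑ k,
      C (Ms i j k + Ms j i k + Ms k i j) * (X i ^ 2 * X j ^ 2 * X k ^ 2 : MvPolynomial V ℝ) := by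
  have h0 : ∑ i, X i ^ 2 * evenForm (Ms i) =
      ∑ i, ∑ j, ∑ k, C (Ms i j k) * (X i ^ 2 * X j ^ 2 * X k ^ 2 : MvPolynomial V ℝ) := by
    simp only [evenForm, Finset.mul_sum]
    exact Finset.sum_congr rfl fun i _ => Finset.sum_congr rfl fun j _ =>
      Finset.sum_congr rfl fun k _ => by ring
  have h1 : ∑ i, ∑ j, ∑ k, C (Ms j i k) * (X i ^ 2 * X j ^ 2 * X k ^ 2 : MvPolynomial V ℝ) =
      ∑ i, ∑ j, ∑ k, C (Ms i j k) * (X i ^ 2 * X j ^ 2 * X k ^ 2 : MvPolynomial V ℝ) :=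
    (sum₃_swap fun i j k => C (Ms j i k) * (X i ^ 2 * X j ^ 2 * X k ^ 2 : MvPolynomial V ℝ)).trans
      (Finset.sum_congr rfl fun i _ => Finset.sum_congr rfl fun j _ =>
        Finset.sum_congr rfl fun k _ => by ring)
  have h2 : ∑ i, ∑ j, ∑ k, C (Ms k i j) * (X i ^ 2 * X j ^ 2 * X k ^ 2 : MvPolynomial V ℝ) =
      ∑ i, ∑ j, ∑ k, C (Ms i j k) * (X i ^ 2 * X j ^ 2 * X k ^ 2 : MvPolynomial V ℝ) :=
    (sum₃_cycl fun i j k => C (Ms k i j) * (X i ^ 2 * X j ^ 2 * X k ^ 2 : MvPolynomial V ℝ)).trans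
      (Finset.sum_congr rfl fun i _ => Finset.sum_congr rfl fun j _ =>
        Finset.sum_congr rfl fun k _ => by ring)
  have h3 : ∑ i, ∑ j, ∑ k, C (Ms i j k + Ms j i k + Ms k i j) *
      (X i ^ 2 * X j ^ 2 * X k ^ 2 : MvPolynomial V ℝ) =
      (∑ i, ∑ j, ∑ k, C (Ms i j k) * (X i ^ 2 * X j ^ 2 * X k ^ 2 : MvPolynomial V ℝ)) +
      (∑ i, ∑ j, ∑ k, C (Ms j i k) * (X i ^ 2 * X j ^ 2 * X k ^ 2 : MvPolynomial V ℝ)) +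
      ∑ i, ∑ j, ∑ k, C (Ms k i j) * (X i ^ 2 * X j ^ 2 * X k ^ 2 : MvPolynomial V ℝ) := by
    simp only [← Finset.sum_add_distrib, map_add, add_mul]
  rw [h3, h1, h2, h0]
  ring

omit [DecidableEq V] in
/-- **[Gvozdenović–Laurent] sufficient condition for membership in `K^{(t+1)}_n`**
[cite: Gvozdenovic2008, Lemma 4.2.3] (originally Gvozdenović–Laurent [GvozdenovicLaurent2006]): if
there are matrices
`M⁽ⁱ⁾` (`i ∈ V`) with `M - M⁽ⁱ⁾ ∈ K^{(t)}_n` for all `i` and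
`M⁽ⁱ⁾_{jk} + M⁽ʲ⁾_{ik} + M⁽ᵏ⁾_{ij} ≥ 0` for all `i, j, k`, then `M ∈ K^{(t+1)}_n`. (With `t = 0` this
is the sufficiency half of the Bomze–de Klerk description of `K^{(1)}_n`
[cite: Gvozdenovic2008, Thm 4.2.2].) -/
theorem inParriloCone_succ_of_decomposition {t : ℕ} {M : Matrix V V ℝ} (Ms : V → Matrix V V ℝ)
    (hK : ∀ i, InParriloCone t (M - Ms i)) (hpos : ∀ i j k, 0 ≤ Ms i j k + Ms j i k + Ms k i j) :
    InParriloCone (t + 1) M := by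
  have hlin : ∀ i, evenForm M = evenForm (M - Ms i) + evenForm (Ms i) := fun i => by
    unfold evenForm
    rw [← Finset.sum_add_distrib]
    refine Finset.sum_congr rfl fun a _ => ?_
    rw [← Finset.sum_add_distrib]
    refine Finset.sum_congr rfl fun b _ => ?_
    rw [Matrix.sub_apply, map_sub]
    ring
  have hsplit : (∑ i, X i ^ 2 : MvPolynomial V ℝ) ^ (t + 1) * evenForm M =
      (∑ i, X i ^ 2 * ((∑ l, X l ^ 2 : MvPolynomial V ℝ) ^ t * evenForm (M - Ms i))) +
        (∑ l, X l ^ 2 : MvPolynomial V ℝ) ^ t * ∑ i, X i ^ 2 * evenForm (Ms i) := by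
    calc (∑ i, X i ^ 2 : MvPolynomial V ℝ) ^ (t + 1) * evenForm M
        = ∑ i, (∑ l, X l ^ 2 : MvPolynomial V ℝ) ^ t * X i ^ 2 * evenForm M := by
          rw [pow_succ, Finset.mul_sum, Finset.sum_mul]
      _ = ∑ i, (X i ^ 2 * ((∑ l, X l ^ 2 : MvPolynomial V ℝ) ^ t * evenForm (M - Ms i)) +
            (∑ l, X l ^ 2 : MvPolynomial V ℝ) ^ t * (X i ^ 2 * evenForm (Ms i))) :=
          Finset.sum_congr rfl fun i _ => by rw [hlin i]; ring
      _ = _ := by rw [Finset.sum_add_distrib, Finset.mul_sum]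
  rw [InParriloCone, hsplit]
  refine IsSumSq.add (IsSumSq.sum fun i _ => ?_) ((isSumSq_pow isSumSq_sumSq t).mul ?_)
  · rw [sq]; exact (IsSumSq.mul_self (X i)).mul (hK i)
  · -- `S = (1/3) · 3S` and `3S` is a nonnegative combination of the squares `(xᵢxⱼx_k)²`
    have h3 : IsSumSq (3 * ∑ i, X i ^ 2 * evenForm (Ms i)) := by
      rw [three_mul_sum_X_sq_mul_evenForm]
      refine IsSumSq.sum fun i _ => IsSumSq.sum fun j _ => IsSumSq.sum fun k _ => ?_
      have : (X i ^ 2 * X j ^ 2 * X k ^ 2 : MvPolynomial V ℝ) = (X i * X j * X k) * (X i * X j * X k) := by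
        ring
      rw [this]
      exact (isSumSq_C (hpos i j k)).mul (IsSumSq.mul_self _)
    have : ∑ i, X i ^ 2 * evenForm (Ms i) = C (1 / 3 : ℝ) * (3 * ∑ i, X i ^ 2 * evenForm (Ms i)) := by
      rw [← mul_assoc, show (3 : MvPolynomial V ℝ) = C 3 from (map_ofNat C 3).symm, ← map_mul]
      norm_num
    rw [this]
    exact (isSumSq_C (by norm_num)).mul h3

/-! ### `K^{(0)}_n = 𝒮⁺_n + 𝒩_n` (Parrilo): the hard inclusion -/

omit [DecidableEq V] in
/-- `P_M = ∑ M_{ij} · x^{2eᵢ + 2eⱼ}` as a sum of monomials. [folklore] -/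
@[folklore] private theorem evenForm_eq_sum_monomial (M : Matrix V V ℝ) :
    evenForm M = ∑ i, ∑ j, monomial (Finsupp.single i 2 + Finsupp.single j 2) (M i j) := by
  unfold evenForm
  refine Finset.sum_congr rfl fun i _ => Finset.sum_congr rfl fun j _ => ?_
  rw [X_pow_eq_monomial, X_pow_eq_monomial, C_mul_monomial, monomial_mul, mul_one, mul_one]

omit [DecidableEq V] in
/-- `P_M` is a quartic form. [folklore] -/
@[folklore] private theorem evenForm_isHomogeneous (M : Matrix V V ℝ) :
    (evenForm M).IsHomogeneous 4 := by
  rw [evenForm_eq_sum_monomial]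
  refine IsHomogeneous.sum _ _ _ fun i _ => IsHomogeneous.sum _ _ _ fun j _ => ?_
  exact isHomogeneous_monomial _ (by rw [map_add, Finsupp.degree_single, Finsupp.degree_single])

/-- The coefficients of `P_M`. [folklore] -/
@[folklore] private theorem coeff_evenForm (M : Matrix V V ℝ) (n : V →₀ ℕ) :
    coeff n (evenForm M) =
      ∑ i, ∑ j, if Finsupp.single i 2 + Finsupp.single j 2 = n then M i j else 0 := by
  simp only [evenForm_eq_sum_monomial, coeff_sum, coeff_monomial]

omit [Fintype V] [DecidableEq V] in
/-- `2e_a + 2e_b = 4e_i` iff `a = b = i`. [folklore] -/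
@[folklore] private theorem single_two_add_eq_single_four_iff {a b i : V} :
    Finsupp.single a 2 + Finsupp.single b 2 = Finsupp.single i 4 ↔ a = i ∧ b = i := by
  constructor
  · intro h
    have ha := DFunLike.congr_fun h a
    have hb := DFunLike.congr_fun h b
    rw [Finsupp.add_apply, Finsupp.single_eq_same] at ha hb
    have hai : a = i := by
      by_contra hai
      rw [Finsupp.single_eq_of_ne hai] at ha
      omega
    have hbi : b = i := by
      by_contra hbi
      rw [Finsupp.single_eq_of_ne hbi] at hb
      omega
    exact ⟨hai, hbi⟩
  · rintro ⟨rfl, rfl⟩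
    rw [← Finsupp.single_add]

omit [Fintype V] [DecidableEq V] in
/-- `2e_a + 2e_b = 2e_i + 2e_k` (`i ≠ k`) iff `(a, b) ∈ {(i, k), (k, i)}`. [folklore] -/
@[folklore] private theorem single_two_add_eq_pair_iff {a b i k : V} (hik : i ≠ k) :
    Finsupp.single a 2 + Finsupp.single b 2 = Finsupp.single i 2 + Finsupp.single k 2 ↔
      (a = i ∧ b = k) ∨ (a = k ∧ b = i) := by
  constructor
  · intro h
    have ha := DFunLike.congr_fun h a
    simp only [Finsupp.add_apply, Finsupp.single_eq_same] at ha
    have haik : a = i ∨ a = k := by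
      by_contra hcon
      push Not at hcon
      rw [Finsupp.single_eq_of_ne hcon.1, Finsupp.single_eq_of_ne hcon.2] at ha
      omega
    rcases haik with rfl | rfl
    · left
      refine ⟨rfl, ?_⟩
      have hk := DFunLike.congr_fun h k
      simp only [Finsupp.add_apply, Finsupp.single_eq_same, Finsupp.single_eq_of_ne hik.symm,
        zero_add] at hk
      by_contra hbk
      rw [Finsupp.single_eq_of_ne (Ne.symm hbk)] at hk
      omega
    · right
      refine ⟨rfl, ?_⟩
      have hi := DFunLike.congr_fun h i
      simp only [Finsupp.add_apply, Finsupp.single_eq_same, Finsupp.single_eq_of_ne hik,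
        zero_add, add_zero] at hi
      by_contra hbi
      rw [Finsupp.single_eq_of_ne (Ne.symm hbi)] at hi
      omega
  · rintro (⟨rfl, rfl⟩ | ⟨rfl, rfl⟩)
    · rfl
    · rw [add_comm]

/-- The coefficient of `xᵢ⁴` in `P_M` is `M_{ii}`. [folklore] -/
@[folklore] private theorem coeff_evenForm_four (M : Matrix V V ℝ) (i : V) :
    coeff (Finsupp.single i 4) (evenForm M) = M i i := by
  rw [coeff_evenForm, Finset.sum_eq_single i (fun a _ ha => Finset.sum_eq_zero fun b _ => by
      rw [if_neg fun h => ha (single_two_add_eq_single_four_iff.1 h).1])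
      (fun h => absurd (Finset.mem_univ i) h),
    Finset.sum_eq_single i (fun b _ hb => by
      rw [if_neg fun h => hb (single_two_add_eq_single_four_iff.1 h).2])
      (fun h => absurd (Finset.mem_univ i) h),
    if_pos (single_two_add_eq_single_four_iff.2 ⟨rfl, rfl⟩)]

/-- The coefficient of `xᵢ²x_k²` (`i ≠ k`) in `P_M` is `M_{ik} + M_{ki}`. [folklore] -/
@[folklore] private theorem coeff_evenForm_pair (M : Matrix V V ℝ) {i k : V} (hik : i ≠ k) :
    coeff (Finsupp.single i 2 + Finsupp.single k 2) (evenForm M) = M i k + M k i := by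
  rw [coeff_evenForm, ← Fintype.sum_prod_type', Finset.sum_ite, Finset.sum_const_zero, add_zero]
  have hset : (Finset.univ.filter fun p : V × V =>
      Finsupp.single p.1 2 + Finsupp.single p.2 2 = Finsupp.single i 2 + Finsupp.single k 2) =
      {(i, k), (k, i)} := by
    ext ⟨a, b⟩
    simp only [Finset.mem_filter, Finset.mem_univ, true_and, Finset.mem_insert,
      Finset.mem_singleton, Prod.mk.injEq]
    exact single_two_add_eq_pair_iff hik
  rw [hset, Finset.sum_pair]
  intro h
  rw [Prod.mk.injEq] at h
  exact hik h.1

omit [Fintype V] in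
/-- In a Gram representation indexed by monomials of degree `≤ 2`, only the pair
`(2eᵢ, 2eᵢ)` produces `xᵢ⁴`. [folklore] -/
@[folklore] private theorem eq_single_two_of_add_eq_single_four {β γ : V →₀ ℕ} {i : V}
    (hβ : β.degree ≤ 2) (hγ : γ.degree ≤ 2) (h : β + γ = Finsupp.single i 4) :
    β = Finsupp.single i 2 ∧ γ = Finsupp.single i 2 := by
  have hdeg : β.degree + γ.degree = 4 := by rw [← map_add, h, Finsupp.degree_single]
  have key : ∀ δ : V →₀ ℕ, δ.degree = 2 → (∀ a, a ≠ i → δ a = 0) → δ = Finsupp.single i 2 := by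
    intro δ hδ hz
    have hrep : δ = Finsupp.single i (δ i) := by
      ext a
      by_cases hai : a = i
      · subst hai; rw [Finsupp.single_eq_same]
      · rw [Finsupp.single_eq_of_ne hai, hz a hai]
    rw [hrep, Finsupp.degree_single] at hδ
    rw [hrep, hδ]
  have hz : ∀ a, a ≠ i → β a = 0 ∧ γ a = 0 := fun a ha => by
    have := DFunLike.congr_fun h a
    rw [Finsupp.add_apply, Finsupp.single_eq_of_ne ha] at this
    omega
  exact ⟨key β (by omega) fun a ha => (hz a ha).1, key γ (by omega) fun a ha => (hz a ha).2⟩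

omit [Fintype V] in
/-- In a Gram representation indexed by monomials of degree `≤ 2`, exactly the pairs
`(2eᵢ, 2e_k), (eᵢ + e_k, eᵢ + e_k), (2e_k, 2eᵢ)` produce `xᵢ²x_k²`. [folklore] -/
@[folklore] private theorem cases_of_add_eq_pair {β γ : V →₀ ℕ} {i k : V} (hik : i ≠ k)
    (hβ : β.degree ≤ 2) (hγ : γ.degree ≤ 2)
    (h : β + γ = Finsupp.single i 2 + Finsupp.single k 2) :
    (β = Finsupp.single i 2 ∧ γ = Finsupp.single k 2) ∨
      (β = Finsupp.single i 1 + Finsupp.single k 1 ∧ γ = Finsupp.single i 1 + Finsupp.single k 1) ∨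
      (β = Finsupp.single k 2 ∧ γ = Finsupp.single i 2) := by
  have hdeg : β.degree + γ.degree = 4 := by
    rw [← map_add, h, map_add, Finsupp.degree_single, Finsupp.degree_single]
  have hz : ∀ a, a ≠ i → a ≠ k → β a = 0 ∧ γ a = 0 := fun a hai hak => by
    have := DFunLike.congr_fun h a
    rw [Finsupp.add_apply, Finsupp.add_apply, Finsupp.single_eq_of_ne hai,
      Finsupp.single_eq_of_ne hak] at this
    omega
  have hi := DFunLike.congr_fun h i
  have hk := DFunLike.congr_fun h k
  rw [Finsupp.add_apply, Finsupp.add_apply, Finsupp.single_eq_same,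
    Finsupp.single_eq_of_ne hik] at hi
  rw [Finsupp.add_apply, Finsupp.add_apply, Finsupp.single_eq_same,
    Finsupp.single_eq_of_ne hik.symm] at hk
  have hrep : ∀ δ : V →₀ ℕ, (∀ a, a ≠ i → a ≠ k → δ a = 0) →
      δ = Finsupp.single i (δ i) + Finsupp.single k (δ k) := fun δ hδ => by
    ext a
    rw [Finsupp.add_apply]
    by_cases hai : a = i
    · subst hai; rw [Finsupp.single_eq_same, Finsupp.single_eq_of_ne hik, add_zero]
    · by_cases hak : a = k
      · subst hak; rw [Finsupp.single_eq_same, Finsupp.single_eq_of_ne hik.symm, zero_add]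
      · rw [Finsupp.single_eq_of_ne hai, Finsupp.single_eq_of_ne hak, hδ a hai hak, add_zero]
  have hβrep := hrep β fun a hai hak => (hz a hai hak).1
  have hγrep := hrep γ fun a hai hak => (hz a hai hak).2
  have hβdeg : β.degree = β i + β k := by
    conv_lhs => rw [hβrep]
    rw [map_add, Finsupp.degree_single, Finsupp.degree_single]
  have hγdeg : γ.degree = γ i + γ k := by
    conv_lhs => rw [hγrep]
    rw [map_add, Finsupp.degree_single, Finsupp.degree_single]
  have hcase : β i = 2 ∨ β i = 1 ∨ β i = 0 := by omega
  rcases hcase with hβi | hβi | hβi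
  · left
    have hβk : β k = 0 := by omega
    have hγi : γ i = 0 := by omega
    have hγk : γ k = 2 := by omega
    rw [hβrep, hγrep, hβi, hβk, hγi, hγk, Finsupp.single_zero, Finsupp.single_zero, add_zero,
      zero_add]
    exact ⟨rfl, rfl⟩
  · right; left
    have hβk : β k = 1 := by omega
    have hγi : γ i = 1 := by omega
    have hγk : γ k = 1 := by omega
    rw [hβrep, hγrep, hβi, hβk, hγi, hγk]
    exact ⟨rfl, rfl⟩
  · right; right
    have hβk : β k = 2 := by omega
    have hγi : γ i = 2 := by omega
    have hγk : γ k = 0 := by omega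
    rw [hβrep, hγrep, hβi, hβk, hγi, hγk, Finsupp.single_zero, Finsupp.single_zero, add_zero,
      zero_add]
    exact ⟨rfl, rfl⟩

/-- `2eᵢ ∈ ℕⁿ_2`. [folklore] -/
@[folklore] private theorem single_two_mem (i : V) : Finsupp.single i 2 ∈ monomialsLE V 2 :=
  mem_monomialsLE.2 (by rw [Finsupp.degree_single])

/-- `eᵢ + e_k ∈ ℕⁿ_2`. [folklore] -/
@[folklore] private theorem single_add_single_mem (i k : V) :
    Finsupp.single i 1 + Finsupp.single k 1 ∈ monomialsLE V 2 :=
  mem_monomialsLE.2 (by rw [map_add, Finsupp.degree_single, Finsupp.degree_single])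

/-- The Gram coefficient at `xᵢ⁴` is the single entry `Q_{2eᵢ,2eᵢ}`. [folklore] -/
@[folklore] private theorem gram_coeff_four (Q : Matrix (monomialsLE V 2) (monomialsLE V 2) ℝ)
    (i : V) :
    (∑ β : monomialsLE V 2, ∑ γ : monomialsLE V 2,
        if β.1 + γ.1 = Finsupp.single i 4 then Q β γ else 0) =
      Q ⟨_, single_two_mem i⟩ ⟨_, single_two_mem i⟩ := by
  rw [Finset.sum_eq_single ⟨_, single_two_mem i⟩ (fun β _ hβ => Finset.sum_eq_zero fun γ _ => by
      rw [if_neg fun h => hβ (Subtype.ext (eq_single_two_of_add_eq_single_four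
        (mem_monomialsLE.1 β.2) (mem_monomialsLE.1 γ.2) h).1)])
      (fun h => absurd (Finset.mem_univ _) h),
    Finset.sum_eq_single ⟨_, single_two_mem i⟩ (fun γ _ hγ => by
      rw [if_neg fun h => hγ (Subtype.ext (eq_single_two_of_add_eq_single_four
        (mem_monomialsLE.1 (single_two_mem i)) (mem_monomialsLE.1 γ.2) h).2)])
      (fun h => absurd (Finset.mem_univ _) h), if_pos]
  change Finsupp.single i 2 + Finsupp.single i 2 = Finsupp.single i 4
  rw [← Finsupp.single_add]

/-- The Gram coefficient at `xᵢ²x_k²` (`i ≠ k`) is `2Q_{2eᵢ,2e_k} + Q_{eᵢ+e_k,eᵢ+e_k}` for a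
symmetric `Q`. [folklore] -/
@[folklore] private theorem gram_coeff_pair (Q : Matrix (monomialsLE V 2) (monomialsLE V 2) ℝ)
    (hQ : ∀ β γ, Q β γ = Q γ β) {i k : V} (hik : i ≠ k) :
    (∑ β : monomialsLE V 2, ∑ γ : monomialsLE V 2,
        if β.1 + γ.1 = Finsupp.single i 2 + Finsupp.single k 2 then Q β γ else 0) =
      2 * Q ⟨_, single_two_mem i⟩ ⟨_, single_two_mem k⟩ +
        Q ⟨_, single_add_single_mem i k⟩ ⟨_, single_add_single_mem i k⟩ := by
  rw [← Fintype.sum_prod_type', Finset.sum_ite, Finset.sum_const_zero, add_zero]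
  set bii : monomialsLE V 2 := ⟨_, single_two_mem i⟩
  set bkk : monomialsLE V 2 := ⟨_, single_two_mem k⟩
  set bik : monomialsLE V 2 := ⟨_, single_add_single_mem i k⟩
  have hset : (Finset.univ.filter fun p : monomialsLE V 2 × monomialsLE V 2 =>
      p.1.1 + p.2.1 = Finsupp.single i 2 + Finsupp.single k 2) =
      {(bii, bkk), (bik, bik), (bkk, bii)} := by
    ext ⟨β, γ⟩
    simp only [Finset.mem_filter, Finset.mem_univ, true_and, Finset.mem_insert,
      Finset.mem_singleton, Prod.mk.injEq]
    constructor
    · intro h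
      rcases cases_of_add_eq_pair hik (mem_monomialsLE.1 β.2) (mem_monomialsLE.1 γ.2) h with
        ⟨h1, h2⟩ | ⟨h1, h2⟩ | ⟨h1, h2⟩
      · exact Or.inl ⟨Subtype.ext h1, Subtype.ext h2⟩
      · exact Or.inr (Or.inl ⟨Subtype.ext h1, Subtype.ext h2⟩)
      · exact Or.inr (Or.inr ⟨Subtype.ext h1, Subtype.ext h2⟩)
    · rintro (⟨rfl, rfl⟩ | ⟨rfl, rfl⟩ | ⟨rfl, rfl⟩)
      · rfl
      · change Finsupp.single i 1 + Finsupp.single k 1 + (Finsupp.single i 1 + Finsupp.single k 1) =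
          Finsupp.single i 2 + Finsupp.single k 2
        rw [add_add_add_comm, ← Finsupp.single_add, ← Finsupp.single_add]
      · exact add_comm _ _
  have hne1 : Finsupp.single i 2 ≠ Finsupp.single i 1 + Finsupp.single k 1 := fun h => by
    have := DFunLike.congr_fun h k
    rw [Finsupp.add_apply, Finsupp.single_eq_same, Finsupp.single_eq_of_ne hik.symm,
      Finsupp.single_eq_of_ne hik.symm] at this
    omega
  have hne2 : Finsupp.single i 2 ≠ Finsupp.single k 2 := fun h => by
    have := DFunLike.congr_fun h i
    rw [Finsupp.single_eq_same, Finsupp.single_eq_of_ne hik] at this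
    omega
  have hne3 : Finsupp.single i 1 + Finsupp.single k 1 ≠ Finsupp.single k 2 := fun h => by
    have := DFunLike.congr_fun h i
    rw [Finsupp.add_apply, Finsupp.single_eq_same, Finsupp.single_eq_of_ne hik,
      Finsupp.single_eq_of_ne hik] at this
    omega
  rw [hset, Finset.sum_insert, Finset.sum_insert, Finset.sum_singleton, hQ bkk bii]
  · ring
  · simp only [Finset.mem_singleton, Prod.mk.injEq, not_and]
    intro h; exact absurd (congrArg Subtype.val h) hne3
  · simp only [Finset.mem_insert, Finset.mem_singleton, Prod.mk.injEq, not_or, not_and]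
    exact ⟨fun h => absurd (congrArg Subtype.val h) hne1,
      fun h => absurd (congrArg Subtype.val h) hne2⟩

/-- **Parrilo's characterisation of `K^{(0)}_n`, hard inclusion** [cite: LaurentVargas2022, Prop 3.7]
[cite: Gvozdenovic2008, §4.2.1 ("Parrilo showed K^{(0)}_n = S_n^+ + N_n")]: if `P_M` is a sum of
squares (`M` symmetric) then `M = P + N` with `P ⪰ 0` and `N ≥ 0` entrywise, `N_{ii} = 0`.
(Gram matrix `Q ⪰ 0` of the SOS certificate on the monomials of degree `≤ 2`: comparing the
coefficients of `xᵢ⁴` and `xᵢ²x_k²` gives `M_{ii} = Q_{2eᵢ,2eᵢ}` and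
`2M_{ik} = 2Q_{2eᵢ,2e_k} + Q_{eᵢ+e_k,eᵢ+e_k}`; take `P = (Q_{2eᵢ,2e_k})_{ik}`.) -/
theorem exists_posSemidef_add_nonneg_of_inParriloCone_zero {M : Matrix V V ℝ} (hM : Mᵀ = M)
    (h : InParriloCone 0 M) :
    ∃ P N : Matrix V V ℝ, P.PosSemidef ∧ (∀ i j, 0 ≤ N i j) ∧ (∀ i, N i i = 0) ∧ M = P + N := by
  rw [InParriloCone, pow_zero, one_mul] at h
  have hdeg : (evenForm M).totalDegree ≤ 2 * 2 := (evenForm_isHomogeneous M).totalDegree_le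
  obtain ⟨Q, hQ, hcoef⟩ := (isSumSq_iff_exists_posSemidef_coeff hdeg).1 h
  have hQsym : ∀ β γ, Q β γ = Q γ β := fun β γ => by
    simpa using (hQ.1.apply β γ).symm
  set e : V → monomialsLE V 2 := fun i => ⟨_, single_two_mem i⟩ with he
  have hdiag : ∀ i, M i i = Q (e i) (e i) := fun i => by
    rw [← coeff_evenForm_four M i, hcoef, gram_coeff_four]
  have hoff : ∀ i k, i ≠ k → M i k + M k i =
      2 * Q (e i) (e k) + Q ⟨_, single_add_single_mem i k⟩ ⟨_, single_add_single_mem i k⟩ :=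
    fun i k hik => by rw [← coeff_evenForm_pair M hik, hcoef, gram_coeff_pair Q hQsym hik]
  have hsymM : ∀ i k, M k i = M i k := fun i k => by
    have := congr_fun (congr_fun hM i) k
    rwa [transpose_apply] at this
  refine ⟨Q.submatrix e e, fun i k => if i = k then 0 else
      Q ⟨_, single_add_single_mem i k⟩ ⟨_, single_add_single_mem i k⟩ / 2,
    hQ.submatrix e, fun i k => ?_, fun i => if_pos rfl, ?_⟩
  · dsimp only
    split_ifs
    · exact le_rfl
    · exact div_nonneg hQ.diag_nonneg (by norm_num)
  · ext i k
    rw [Matrix.add_apply, submatrix_apply]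
    by_cases hik : i = k
    · subst hik
      rw [if_pos rfl, add_zero]
      exact hdiag i
    · rw [if_neg hik]
      have h1 := hoff i k hik
      have h2 := hsymM i k
      linarith

/-- **Parrilo's theorem `K^{(0)}_n = 𝒮⁺_n + 𝒩_n`** [cite: LaurentVargas2022, Prop 3.7]
[cite: Gvozdenovic2008, §4.2.1 ("K^{(0)}_n = S_n^+ + N_n")] [cite: DeklerkPasechnik2002, §4]: for a
symmetric matrix `M`, the form `∑ M_{ij} xᵢ²xⱼ²` is a sum of squares iff `M = P + N` with `P`
positive semidefinite and `N` entrywise nonnegative (and one may take `N_{ii} = 0`). -/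
theorem inParriloCone_zero_iff {M : Matrix V V ℝ} (hM : Mᵀ = M) :
    InParriloCone 0 M ↔
      ∃ P N : Matrix V V ℝ, P.PosSemidef ∧ (∀ i j, 0 ≤ N i j) ∧ (∀ i, N i i = 0) ∧ M = P + N :=
  ⟨exists_posSemidef_add_nonneg_of_inParriloCone_zero hM,
    fun ⟨_, _, hP, hN, _, hMPN⟩ => inParriloCone_zero_of_posSemidef_add_nonneg hP hN hMPN⟩

/-- Consequently (`K^{(0)}_n ⊆ COP_n` made explicit): `P ⪰ 0` plus `N ≥ 0` is copositive — the
"`𝒮⁺ + 𝒩`" inner approximation of the copositive cone that underlies `ϑ^{(0)} = ϑ'`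
[cite: LaurentVargas2022, §1 ("ϑ^{(0)}(G) coincides with ϑ'(G)")] [cite: DeklerkPasechnik2002, §4]. -/
theorem copositive_of_posSemidef_add_nonneg {M P N : Matrix V V ℝ} (hP : P.PosSemidef)
    (hN : ∀ i j, 0 ≤ N i j) (hM : M = P + N) (x : V → ℝ) (hx : ∀ i, 0 ≤ x i) :
    0 ≤ x ⬝ᵥ M *ᵥ x :=
  (inParriloCone_zero_of_posSemidef_add_nonneg hP hN hM).copositive x hx

end Cones

end Literature.Algebra.Polynomial.ParriloCopositiveSos
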